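import Summits.ResolutionOfSingularities.ResolutionOfSingularities.Theorems.PurelyInseparableDim4ScopeBlindCert
import HarnessLib

/-!
# A `decide`-able BLINDNESS certificate along RATIONAL curves `xᵢ = cᵢ t^{wᵢ} / D(t)^{vᵢ}`
# (cell `res-dim4-pi`; scope column of the trap census ‖ K; graph-type components)

[OURS · counted 0 · instrument] Nothing here is a statement about resolution of singularities.
`…ScopeBlindCert` certifies OUT-of-coordinate-scope (`¬ InCoordinateScope q F`) by a MONOMIAL curve inside
`V(J_q⁺(F))`; it cannot reach the GRAPH-TYPE regular components that dominate the `p = 2` trap census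
(e.g. `x₄(1 + x₃) = x₃`, T-002's `x₄(1 + x₂) + εx₂ = 0`, RUN 4b's `x₃ = x₂³ / (1 + x₂³)`).  This file adds the
rational version, still checked by `decide` on presented states (`StepKit.SData`):

* §1 products / powers of term lists (`mulTL`, `mulL`, `powL`) with transfer to `evalT`;
* §2 the curve `xᵢ = cᵢ t^{wᵢ} · D(t)^{-vᵢ}` in `K⟦t⟧` (`D : Terms 1 K` with `D(0) ≠ 0`, inverted as a power
  series): the CLEARED evaluation `rcurveLN c w v D N L` (a term list in `t`, `= D^N · L|curve`) and the transfer
  `D^N · φ(evalT L) = ψ(evalT (rcurveLN …))`, so `J_q⁺` vanishing on the curve is a finite coefficient check;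
* §3 **`rblindB q s c w v D α₀ a`** and **`not_inCoordinateScope_of_rblindB`** (soundness via res-dim4-p-3's
  ring-map certificate `IsolationCert.not_inCoordinateScope_of_ringHom`);
* §4 acceptance: RUN 4b's hand-certified 13th scope-game trap (eng-w5 17:12:38Z, root S1a-15533fda18) and the
  census shape `x₃x₄² + x₃³ + x₃³x₄²` (`V(J₂⁺) = {x₄(1+x₃) = x₃}`), each OUT of scope by `decide`.
OURS; counted 0.  bears_on: LADDER-RESOLUTION:D157-DOOR2 (res-dim4-pi · frame v4 scope column · F4-C instrument).
Supports stmt-ResolutionOfSingularities-16155 (helper).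
-/

set_option linter.dupNamespace false -- mandated namespace of this single-conjunct summit

noncomputable section

open MvPolynomial Finset

namespace Summit.ResolutionOfSingularities.ResolutionOfSingularities.Theorems.PIDim4

namespace ScopeBlind

open StepKit ScopeCover
open Literature.AlgebraicGeometry.Resolution

variable {K : Type} [Field K] {n : ℕ}

/-! ## §1 Products and powers of term lists -/

/-- `expo` is additive. [folklore] -/
theorem expo_add (e e' : Fin n → ℕ) : expo (e + e') = expo e + expo e' := Finsupp.ext fun _ => rfl

/-- A single term times a term list. [folklore] -/
def mulTL (t : (Fin n → ℕ) × K) (B : Terms n K) : Terms n K := B.map fun u => (t.1 + u.1, t.2 * u.2)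

/-- Transfer of `mulTL`. [folklore] -/
theorem evalT_mulTL (t : (Fin n → ℕ) × K) (B : Terms n K) :
    evalT (mulTL t B) = monomial (expo t.1) t.2 * evalT B := by
  induction B with
  | nil => simp [mulTL, evalT]
  | cons u B ih =>
    simp only [mulTL, List.map_cons, evalT_cons] at ih ⊢
    rw [ih, mul_add, monomial_mul, expo_add]

/-- Product of term lists. [folklore] -/
def mulL : Terms n K → Terms n K → Terms n K
  | [], _ => []
  | t :: A, B => mulTL t B ++ mulL A B

/-- Transfer of `mulL`. [folklore] -/
theorem evalT_mulL (A B : Terms n K) : evalT (mulL A B) = evalT A * evalT B := by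
  induction A with
  | nil => simp [mulL, evalT]
  | cons t A ih => rw [mulL, evalT_append, evalT_mulTL, ih, evalT_cons, add_mul]

/-- Powers of a term list. [folklore] -/
def powL (D : Terms n K) : ℕ → Terms n K
  | 0 => [(fun _ => 0, 1)]
  | m + 1 => mulL (powL D m) D

/-- Transfer of `powL`. [folklore] -/
theorem evalT_powL (D : Terms n K) (m : ℕ) : evalT (powL D m) = evalT D ^ m := by
  induction m with
  | zero =>
    have h0 : expo (fun _ : Fin n => (0 : ℕ)) = 0 := (expo_eq_zero_iff _).mpr rfl
    rw [powL, evalT_cons, evalT, add_zero, pow_zero, h0]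
    rfl
  | succ m ih => rw [powL, evalT_mulL, ih, pow_succ]

/-! ## §2 The rational curve in `K⟦t⟧` and the cleared evaluation -/

/-- `K[t]` (presented as `MvPolynomial (Fin 1) K`) into `K⟦t⟧`. [folklore] -/
def psi : MvPolynomial (Fin 1) K →ₐ[K] PowerSeries K := MvPolynomial.aeval fun _ => PowerSeries.X

/-- `psi` on a monomial. -/
theorem psi_monomial (d : Fin 1 → ℕ) (b : K) :
    psi (monomial (expo d) b) = PowerSeries.C b * PowerSeries.X ^ d 0 := by
  rw [psi, monomial_expo_eq, map_mul, MvPolynomial.algHom_C, PowerSeries.C_eq_algebraMap.symm, map_prod]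
  simp only [map_pow, MvPolynomial.aeval_X, Fin.prod_univ_one]

/-- The `t^k`-coefficient of `psi (evalT P)` is the coefficient of `t^k` in the term list `P`. [folklore] -/
theorem coeff_psi_evalT (P : Terms 1 K) (k : ℕ) :
    PowerSeries.coeff k (psi (evalT P)) = coeffAt P (fun _ => k) := by
  induction P with
  | nil => simp [evalT, coeffAt]
  | cons t P ih =>
    rw [evalT_cons, map_add, map_add, ih, coeffAt, psi_monomial, PowerSeries.coeff_C_mul_X_pow]
    congr 1
    have hiff : t.1 = (fun _ => k) ↔ t.1 0 = k := by
      constructor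
      · intro h; rw [h]
      · intro h; funext i; rw [Subsingleton.elim i 0, h]
    by_cases h : t.1 0 = k
    · rw [if_pos h.symm, if_pos (hiff.mpr h)]
    · rw [if_neg (fun h' => h h'.symm), if_neg (fun h' => h (hiff.mp h'))]

/-- The power series of a term list in `t`. -/
def ps (P : Terms 1 K) : PowerSeries K := psi (evalT P)

/-- The rational curve `xᵢ = Pᵢ(t) · D(t)^{-vᵢ}` as an algebra map into `K⟦t⟧` (`D` inverted as a power
series; meaningful when `D(0) ≠ 0`). [folklore] -/
def rcurveHom (P : Fin 4 → Terms 1 K) (v : Fin 4 → ℕ) (D : Terms 1 K) :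
    MvPolynomial (Fin 4) K →ₐ[K] PowerSeries K :=
  MvPolynomial.aeval fun i => ps (P i) * ((ps D)⁻¹) ^ v i

/-- `v`-weight of an exponent (the power of `D` in the denominator of `x^e|curve`). [folklore] -/
def vdeg (v : Fin 4 → ℕ) (e : Fin 4 → ℕ) : ℕ := ∑ i, e i * v i

/-- A common denominator exponent for a term list. [folklore] -/
def maxV (v : Fin 4 → ℕ) (L : Terms 4 K) : ℕ := (L.map fun t => vdeg v t.1).foldr max 0

omit [Field K] in
/-- Every term's `v`-weight is at most `maxV`. -/
theorem vdeg_le_maxV (v : Fin 4 → ℕ) (L : Terms 4 K) : ∀ t ∈ L, vdeg v t.1 ≤ maxV v L := by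
  induction L with
  | nil => simp
  | cons u L ih =>
    intro t ht
    simp only [maxV, List.map_cons, List.foldr_cons]
    rcases List.mem_cons.mp ht with rfl | h
    · exact le_max_left _ _
    · exact (ih t h).trans (le_max_right _ _)

/-- `∏ᵢ Pᵢ^{eᵢ}` as a term list. [folklore] -/
def prodPowL (P : Fin 4 → Terms 1 K) (e : Fin 4 → ℕ) : Terms 1 K :=
  mulL (mulL (mulL (powL (P 0) (e 0)) (powL (P 1) (e 1))) (powL (P 2) (e 2))) (powL (P 3) (e 3))

/-- Transfer of `prodPowL`. -/
theorem ps_prodPowL (P : Fin 4 → Terms 1 K) (e : Fin 4 → ℕ) : ps (prodPowL P e) = ∏ i, ps (P i) ^ e i := by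
  simp only [ps, prodPowL, evalT_mulL, evalT_powL, map_mul, map_pow, Fin.prod_univ_four]

/-- **Cleared evaluation** on the rational curve: `Σ a · ∏ Pᵢ^{eᵢ} · D^{N - Σ eᵢvᵢ}` as a term list in `t`.
[folklore] -/
def rcurveLN (P : Fin 4 → Terms 1 K) (v : Fin 4 → ℕ) (D : Terms 1 K) (N : ℕ) : Terms 4 K → Terms 1 K
  | [] => []
  | t :: L => mulTL (fun _ => 0, t.2) (mulL (prodPowL P t.1) (powL D (N - vdeg v t.1))) ++ rcurveLN P v D N L

/-- The rational curve on a monomial. -/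
theorem rcurveHom_monomial (P : Fin 4 → Terms 1 K) (v : Fin 4 → ℕ) (D : Terms 1 K) (e : Fin 4 → ℕ) (a : K) :
    rcurveHom P v D (monomial (expo e) a) =
      PowerSeries.C a * (∏ i, ps (P i) ^ e i) * ((ps D)⁻¹) ^ vdeg v e := by
  rw [rcurveHom, monomial_expo_eq, map_mul, MvPolynomial.algHom_C, PowerSeries.C_eq_algebraMap.symm, map_prod]
  simp only [map_pow, MvPolynomial.aeval_X, Fin.prod_univ_four, Fin.sum_univ_four, vdeg, mul_pow, ← pow_mul,
    pow_add]
  ring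

/-- `psi` of the constant term `(0, a)`. -/
theorem psi_monomial_zero (a : K) : psi (monomial (expo fun _ : Fin 1 => 0) a) = PowerSeries.C a := by
  rw [psi_monomial, pow_zero, mul_one]

/-- **Transfer**: `D^N · φ(evalT L) = ψ(evalT (rcurveLN … N L))` when `N` bounds the `v`-weights and
`D(0) ≠ 0`. [folklore] -/
theorem rcurve_transfer (P : Fin 4 → Terms 1 K) (v : Fin 4 → ℕ) (D : Terms 1 K)
    (hD : PowerSeries.constantCoeff (ps D) ≠ 0) (N : ℕ) (L : Terms 4 K)
    (hN : ∀ t ∈ L, vdeg v t.1 ≤ N) :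
    ps D ^ N * rcurveHom P v D (evalT L) = psi (evalT (rcurveLN P v D N L)) := by
  induction L with
  | nil => simp [evalT, rcurveLN]
  | cons t L ih =>
    have ht : vdeg v t.1 ≤ N := hN t (by simp)
    have hL : ∀ u ∈ L, vdeg v u.1 ≤ N := fun u hu => hN u (by simp [hu])
    rw [evalT_cons, map_add, mul_add, ih hL, rcurveLN, evalT_append, map_add, evalT_mulTL, map_mul,
      psi_monomial_zero, evalT_mulL, map_mul, evalT_powL, map_pow, rcurveHom_monomial]
    congr 1
    have hsplit : ps D ^ N = ps D ^ (N - vdeg v t.1) * ps D ^ vdeg v t.1 := by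
      rw [← pow_add, Nat.sub_add_cancel ht]
    have hcancel : ps D ^ vdeg v t.1 * (ps D)⁻¹ ^ vdeg v t.1 = 1 := by
      rw [← mul_pow, PowerSeries.mul_inv_cancel _ hD, one_pow]
    show ps D ^ N * (PowerSeries.C t.2 * (∏ i, ps (P i) ^ t.1 i) * (ps D)⁻¹ ^ vdeg v t.1) =
      PowerSeries.C t.2 * (psi (evalT (prodPowL P t.1)) * psi (evalT D) ^ (N - vdeg v t.1))
    rw [hsplit, show psi (evalT D) = ps D from rfl, show psi (evalT (prodPowL P t.1)) = ps (prodPowL P t.1) from rfl,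
      ps_prodPowL]
    calc ps D ^ (N - vdeg v t.1) * ps D ^ vdeg v t.1 *
          (PowerSeries.C t.2 * (∏ i, ps (P i) ^ t.1 i) * (ps D)⁻¹ ^ vdeg v t.1)
        = PowerSeries.C t.2 * ((∏ i, ps (P i) ^ t.1 i) * ps D ^ (N - vdeg v t.1)) *
          (ps D ^ vdeg v t.1 * (ps D)⁻¹ ^ vdeg v t.1) := by ring
      _ = _ := by rw [hcancel, mul_one]

/-- Hence a vanishing cleared evaluation means `φ(evalT L) = 0` (`K⟦t⟧` is a domain, `D ≠ 0`). [folklore] -/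
theorem rcurveHom_evalT_eq_zero (P : Fin 4 → Terms 1 K) (v : Fin 4 → ℕ) (D : Terms 1 K)
    (hD : PowerSeries.constantCoeff (ps D) ≠ 0) (L : Terms 4 K)
    (h : evalT (rcurveLN P v D (maxV v L) L) = 0) : rcurveHom P v D (evalT L) = 0 := by
  have ht := rcurve_transfer P v D hD (maxV v L) L (vdeg_le_maxV v L)
  rw [h, map_zero] at ht
  have hDne : ps D ^ maxV v L ≠ 0 := by
    apply pow_ne_zero
    intro h0; apply hD; rw [h0, map_zero]
  exact (mul_eq_zero.mp ht).resolve_left hDne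

/-- The curve passes through the origin when every `Pᵢ(0) = 0`. [folklore] -/
theorem rcurve_constantCoeff (P : Fin 4 → Terms 1 K) (v : Fin 4 → ℕ) (D : Terms 1 K)
    (hP : ∀ i, coeffAt (P i) (fun _ => 0) = 0) (i : Fin 4) :
    PowerSeries.constantCoeff (ps (P i) * ((ps D)⁻¹) ^ v i) = 0 := by
  rw [map_mul, ← PowerSeries.coeff_zero_eq_constantCoeff_apply, ps, coeff_psi_evalT, hP i, zero_mul]

/-! ## §3 The certificate -/

variable [DecidableEq K]

/-- **Rational blindness check**: curve `xᵢ = Pᵢ(t) D(t)^{-vᵢ}` through `0` (`Pᵢ(0) = 0`), `D(0) ≠ 0`, every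
`D^{(α)}F` (`0 < |α| < q`) vanishes on the curve (cleared coefficient check), `a` vanishes on the index set
`V = {i : coeff_{t^{kᵢ}} Pᵢ = 0}` (off `V` the coordinate `Pᵢ` is certified non-zero), `0 < |α₀| < q` and
`D^{(α₀)}F(a) ≠ 0`. [folklore] -/
def rblindB (q : ℕ) (s : SData 4 K) (P : Fin 4 → Terms 1 K) (v : Fin 4 → ℕ) (D : Terms 1 K) (k : Fin 4 → ℕ)
    (α₀ : Fin 4 → ℕ) (a : Fin 4 → K) : Bool :=
  decide (∀ i, coeffAt (P i) (fun _ => 0) = 0) &&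
    !decide (coeffAt D (fun _ => 0) = 0) &&
    ((idxLT q).all fun α => StepKit.equivB (rcurveLN P v D (maxV v (hasseL α s.L)) (hasseL α s.L)) []) &&
    decide (∀ i, coeffAt (P i) (fun _ => k i) = 0 → a i = 0) &&
    decide (0 < ∑ i, α₀ i ∧ ∑ i, α₀ i < q) &&
    !decide (evalAtL a (hasseL α₀ s.L) = 0)

/-- **Soundness of the rational blindness check** (via res-dim4-p-3's kernel-form certificate). [folklore] -/
theorem not_inCoordinateScope_of_rblindB {q : ℕ} {s : SData 4 K} {P : Fin 4 → Terms 1 K} {v : Fin 4 → ℕ}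
    {D : Terms 1 K} {k α₀ : Fin 4 → ℕ} {a : Fin 4 → K} (h : rblindB q s P v D k α₀ a = true) :
    ¬ InCoordinateScope q s.toState.F := by
  simp only [rblindB, Bool.and_eq_true, decide_eq_true_eq, List.all_eq_true, Bool.not_eq_true',
    decide_eq_false_iff_not] at h
  obtain ⟨⟨⟨⟨⟨hP, hD⟩, hJ⟩, ha⟩, hα₀⟩, hne⟩ := h
  have hD' : PowerSeries.constantCoeff (ps D) ≠ 0 := by
    rwa [← PowerSeries.coeff_zero_eq_constantCoeff_apply, ps, coeff_psi_evalT]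
  have hdeg : (expo α₀).degree = ∑ i, α₀ i := degree_expo α₀
  refine IsolationCert.not_inCoordinateScope_of_ringHom (rcurveHom P v D).toRingHom (fun α h0 hq => ?_)
    (fun g hg => ?_) (Finset.univ.filter fun i => coeffAt (P i) (fun _ => k i) = 0) (fun i hi => ?_)
    (expo α₀) (by rw [hdeg]; exact hα₀.1) (by rw [hdeg]; exact hα₀.2) a (fun i hi => ?_) ?_
  · change rcurveHom P v D (hasseDeriv α s.toState.F) = 0
    rw [SData.toState_F, ← expo_coe α, hasseDeriv_evalT]
    apply rcurveHom_evalT_eq_zero P v D hD'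
    rw [evalT_eq_zero_iff]
    exact hJ (⇑α) (mem_idxLT h0 hq)
  · rw [← IsolationCert.constantCoeff_aeval_curve _ (rcurve_constantCoeff P v D hP) g]
    change PowerSeries.constantCoeff (rcurveHom P v D g) = 0
    rw [show rcurveHom P v D g = 0 from hg, map_zero]
  · change rcurveHom P v D (X i) ≠ 0
    have hki : coeffAt (P i) (fun _ => k i) ≠ 0 := by simpa using hi
    rw [rcurveHom, MvPolynomial.aeval_X]
    have hPi : ps (P i) ≠ 0 := by
      intro h0; apply hki; rw [← coeff_psi_evalT, ← ps, h0, map_zero]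
    have hinv : ((ps D)⁻¹ : PowerSeries K) ≠ 0 := by
      intro h0
      have := PowerSeries.mul_inv_cancel (ps D) hD'
      rw [h0, mul_zero] at this
      exact zero_ne_one this
    exact mul_ne_zero hPi (pow_ne_zero _ hinv)
  · exact ha i (by simpa using hi)
  · rw [SData.toState_F, hasseDeriv_evalT, eval_evalT]
    exact hne

/-- Monomial numerators `Pᵢ = cᵢ t^{wᵢ}` (the common case; `k = w`). [folklore] -/
def monoP (c : Fin 4 → K) (w : Fin 4 → ℕ) : Fin 4 → Terms 1 K := fun i => [(fun _ => w i, c i)]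

/-! ## §4 Acceptance (`p = q = 2`): graph-type components by `decide` -/

/-- The denominator `1 + t`. -/
def onePlusT : Terms 1 (ZMod 2) := [(![0], 1), (![1], 1)]

/-- RUN 4b's 13th scope-game trap, state s₁ = `x₃x₄² + x₂x₄² + x₂x₃x₄² + x₁x₃ + x₁x₂` (exc `{x₄}`): `V(J₂⁺) ⊇
{x₃ = x₂, x₁ = x₄²(1+x₂)}` (eng-w5 17:12:38Z, by hand). -/
def r4b13a : SData 4 (ZMod 2) :=
  ⟨[(![0, 0, 1, 2], 1), (![0, 1, 0, 2], 1), (![0, 1, 1, 2], 1), (![1, 0, 1, 0], 1), (![1, 1, 0, 0], 1)], ![0, 0, 0, 0], {3}⟩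

/-- … state s₂ = `x₃x₄ + x₂x₄ + x₂x₃x₄² + x₁x₃ + x₁x₂`: `V(J₂⁺) ⊇ {x₃ = x₂, x₁ = x₄ + x₂x₄²}`. -/
def r4b13b : SData 4 (ZMod 2) :=
  ⟨[(![0, 0, 1, 1], 1), (![0, 1, 0, 1], 1), (![0, 1, 1, 2], 1), (![1, 0, 1, 0], 1), (![1, 1, 0, 0], 1)], ![0, 0, 0, 0], {3}⟩

/-- The census shape `x₃x₄² + x₃³ + x₃³x₄²` (RUN 4b traps c1630bbb…, ff00d169…, 7e0c629f…): `V(J₂⁺) = {x₄(1+x₃) = x₃}`,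
a regular NON-coordinate hypersurface germ, reached only by the rational curve `x₃ = t`, `x₄ = t/(1+t)`. -/
def r4bGraph : SData 4 (ZMod 2) :=
  ⟨[(![0, 0, 1, 2], 1), (![0, 0, 3, 0], 1), (![0, 0, 3, 2], 1)], ![0, 0, 0, 0], {0}⟩

/-- RUN 1 census state `x₃x₄ + x₂x₄ + x₂x₃ + x₂²x₄ + x₂³ + x₂³x₄` (trap f465f068…, exc `{x₁}`): `V(J₂⁺) ⊇ {x₄ = x₂,
x₃ = x₂ + x₂² + x₂³}` — a POLYNOMIAL, non-monomial numerator. -/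
def r1poly : SData 4 (ZMod 2) :=
  ⟨[(![0, 0, 1, 1], 1), (![0, 1, 0, 1], 1), (![0, 1, 1, 0], 1), (![0, 2, 0, 1], 1), (![0, 3, 0, 0], 1),
    (![0, 3, 0, 1], 1)], ![0, 0, 0, 0], {0}⟩

/-- s₁ passes the check along the monomial curve `(t², 0, 0, t)` (`v = 0`), witness `∂₂F(1,0,0,0) = 1`. -/
theorem rblindB_r4b13a : rblindB 2 r4b13a (monoP ![1, 0, 0, 1] ![2, 0, 0, 1]) ![0, 0, 0, 0] onePlusT
    ![2, 0, 0, 1] ![0, 1, 0, 0] ![1, 0, 0, 0] = true := by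
  decide

/-- s₂ passes the check along `(t, 0, 0, t)`, witness `∂₂F(1,0,0,0) = 1`. -/
theorem rblindB_r4b13b : rblindB 2 r4b13b (monoP ![1, 0, 0, 1] ![1, 0, 0, 1]) ![0, 0, 0, 0] onePlusT
    ![1, 0, 0, 1] ![0, 1, 0, 0] ![1, 0, 0, 0] = true := by
  decide

/-- The graph shape passes the check along the RATIONAL curve `(0, 0, t, t/(1+t))` (`v = (0,0,0,1)`), witness
`∂₃F(0,0,0,1) = 1`. -/
theorem rblindB_r4bGraph : rblindB 2 r4bGraph (monoP ![0, 0, 1, 1] ![0, 0, 1, 1]) ![0, 0, 0, 1] onePlusT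
    ![0, 0, 1, 1] ![0, 0, 1, 0] ![0, 0, 0, 1] = true := by
  decide

/-- The polynomial-numerator state passes along `(0, t, t + t² + t³, t)`, witness `∂₃F(0,0,0,1) = 1`. -/
theorem rblindB_r1poly : rblindB 2 r1poly ![[], [(![1], 1)], [(![1], 1), (![2], 1), (![3], 1)], [(![1], 1)]]
    ![0, 0, 0, 0] onePlusT ![0, 1, 1, 1] ![0, 0, 1, 0] ![0, 0, 0, 1] = true := by
  decide

/-- **RUN 4b's 13th scope-game trap is NOT an F4-C kill candidate** (kernel): both its states are OUT of
coordinate scope. [folklore] -/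
theorem not_inCoordinateScope_r4b13 :
    ¬ InCoordinateScope 2 r4b13a.toState.F ∧ ¬ InCoordinateScope 2 r4b13b.toState.F :=
  ⟨not_inCoordinateScope_of_rblindB rblindB_r4b13a, not_inCoordinateScope_of_rblindB rblindB_r4b13b⟩

/-- **The graph shape `x₃x₄² + x₃³ + x₃³x₄²` is OUT of coordinate scope** (kernel). [folklore] -/
theorem not_inCoordinateScope_r4bGraph : ¬ InCoordinateScope 2 r4bGraph.toState.F :=
  not_inCoordinateScope_of_rblindB rblindB_r4bGraph

/-- **The polynomial-numerator census state is OUT of coordinate scope** (kernel). [folklore] -/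
theorem not_inCoordinateScope_r1poly : ¬ InCoordinateScope 2 r1poly.toState.F :=
  not_inCoordinateScope_of_rblindB rblindB_r1poly

end ScopeBlind

end Summit.ResolutionOfSingularities.ResolutionOfSingularities.Theorems.PIDim4
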